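import Summits.HubbardSuperconductivity.HubbardSuperconductivity.Theorems.ThermalWedgeTwTipContinuationCrossRoute
import Summits.HubbardSuperconductivity.HubbardSuperconductivity.Theorems.ChiralWindowCwThesisBlockGroundEnergy
import Summits.HubbardSuperconductivity.HubbardSuperconductivity.Theorems.NoGoNogoThesis
import Literature.MathematicalPhysics.QuantumLattice.LiebFluxPhaseProofs
import Literature.MathematicalPhysics.QuantumLattice.HubbardWave0LiebProofs

/-!
# `TwTipContinuation` (stmt-HubbardSuperconductivity-1700) — line `SketchK5`: the CONVERSE sandwich
# (why stub (A) is the canonical pair-penalty response, modulo order-blind depletion)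

Helpers for the crux `TwTipContinuation` of route `ThermalWedge` (line lead, continuation seat c4),
riding `--supports stmt-HubbardSuperconductivity-1700`. Notation as in
`…Theorems.ThermalWedgeTwTipContinuationSharpSandwich` (lead a1, p107763): `H_L = hubbardTorus 2 L 1 U`,
`P_L = Δ_dᴴ Δ_d`, `p` = Lieb's `(n_L,n_L)` occupation sector with `n_L = ⌊(1−δ)L²/2⌋`,
`A_L = H_L|_p`, `B_L(κ) = (H_L + (κ/L⁴) P_L)|_p`, `F_β(K) = −β⁻¹ log Re Z_β(K)`, `E₀(K)` the ground
energy, `D_β(K) = E₀(K) − F_β(K) ≥ 0` the depletion.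

The landed transfer (a1) reads: stub (A) `a κ ≤ F_{CL}(B_L) − F_{CL}(A_L)` AND the order-blind
depletion (B) `D_{CL}(A_L) ≤ ε` of the PURE block give the canonical zero-temperature penalty
response `c κ ≤ E₀(B_L) − E₀(A_L)` (`penaltyResponseWindow_of_thermal`). This file proves the
converse bookkeeping:

* `freeEnergy_sub_ge_of_groundEnergy_sub` — spectral form: `x + y ≤ E₀(B) − E₀(A)` and
  `D_β(B) ≤ y` give `x ≤ F_β(B) − F_β(A)` (since `F_β(A) ≤ E₀(A)`);
* `thermalPenalty_of_penaltyResponse_of_depletion` — window form: the canonical pair-penalty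
  response window (the hypothesis of the landed door
  `CrossRoute.twTipContinuation_of_penaltyResponseWindow`, verbatim) AND the order-blind depletion
  of the PENALISED blocks `D_{CL}(B_L(κ)) ≤ ε` (every `κ ≥ 0`; at `κ = 0` this is stub (B)) imply the
  body of stub (A) `stub_thermalPenalty` of `Lines/SketchK5.lean`, verbatim, with `a = c/2`.

So, modulo order-blind depletion bounds at the schedule `β_L = C·L` (true for any spectrum with
`e^{o(L)}` states per energy window `1/(CL)`; neither proved nor refuted for the weakly repulsive
torus), stub (A) IS the fixed-`κ` zero-temperature penalty response, which at each `(U,δ)` implies the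
summit matrix (`CwThesis.stub_penaltyResponseLRO`, landed) — the line relocates the every-ground-state
weak-coupling d-wave order of the pure torus into (A); it does not divide it.

Sources: Ruelle, *Statistical Mechanics* (1969) §2.5 (`F_β ≤ E₀`, `D_β ≥ 0`); Tasaki (2020) §2.2.
No definition is introduced; the file is import-independent of the a1 module (the three one-line
facts it shares with it — `F_β ≤ E₀`, sector nonemptiness, Hermiticity of the penalised torus — are
re-derived inline inside the proofs, not re-declared).
-/

noncomputable section

-- `dupNamespace`: the summit and the problem are both named `HubbardSuperconductivity` (layout D-0022)
set_option linter.dupNamespace false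
-- the `(n,n)`-sector index type `{s : Finset (Orb Λ) // …}` needs a larger instance budget for
-- `DecidableEq` (structural instance through `Lex (Fin 2 → Fin L)`; tree precedent: CwThesisBlockGroundEnergy)
set_option synthInstance.maxSize 512

namespace Summit.HubbardSuperconductivity.TwTipContinuation.SharpSandwich

open Matrix Filter Literature.MathematicalPhysics.QuantumLattice Literature.Probability.LatticeModels
open scoped ComplexOrder

/-! ### Spectral form -/

section Generic

variable {m : Type*} [Fintype m] [DecidableEq m]

/-- **Converse sandwich, spectral form.** For Hermitian `A` (nonempty index type), `β > 0` and any
matrix `B`: a zero-temperature response `x + y ≤ E₀(B) − E₀(A)` and a depletion bound for the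
PERTURBED matrix `E₀(B) − F_β(B) ≤ y` give the thermal response `x ≤ F_β(B) − F_β(A)`
(since `F_β(A) ≤ E₀(A)`). Ruelle (1969) §2.5. [folklore] -/
theorem freeEnergy_sub_ge_of_groundEnergy_sub [Nonempty m] {A B : Matrix m m ℂ} (hA : A.IsHermitian)
    {β x y : ℝ} (hβ : 0 < β)
    (hresp : x + y ≤ B.groundEnergy - A.groundEnergy)
    (hdep : B.groundEnergy - -(1 / β) * Real.log (partitionFn β B).re ≤ y) :
    x ≤ -(1 / β) * Real.log (partitionFn β B).re - -(1 / β) * Real.log (partitionFn β A).re := by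
  -- `F_β(A) ≤ E₀(A)`: keep the ground-state term of `Z_β(A)` (`e^{-βE₀} ≤ Z_β`)
  have hFA : -(1 / β) * Real.log (partitionFn β A).re ≤ A.groundEnergy := by
    have h2 := Real.log_le_log (Real.exp_pos _) (exp_neg_mul_groundEnergy_le_partitionFn hA β)
    rw [Real.log_exp] at h2
    have h3 : -(β * A.groundEnergy) * (1 / β) ≤ Real.log (partitionFn β A).re * (1 / β) :=
      mul_le_mul_of_nonneg_right h2 (by positivity)
    have hs : -(β * A.groundEnergy) * (1 / β) = -A.groundEnergy := by field_simp
    rw [hs] at h3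
    nlinarith
  linarith

end Generic

/-! ### Window form: penalty response ∧ depletion of the penalised blocks ⇒ stub (A) -/

/-- An even side `L ≥ 2` is `2(k+1)` for some `k`, with `k + 1 ≥ L/2`. [folklore] -/
theorem exists_eq_two_mul_succ {L : ℕ} (hL : Even L) (h2 : 2 ≤ L) : ∃ k : ℕ, L = 2 * (k + 1) := by
  obtain ⟨r, hr⟩ := hL
  refine ⟨r - 1, ?_⟩
  omega

/-- **Penalty response ∧ depletion of the penalised blocks ⇒ the thermal penalty stub (A).**
Hypotheses: `hP` = the canonical pair-penalty response window (the hypothesis of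
`CrossRoute.twTipContinuation_of_penaltyResponseWindow`, verbatim: at one `δ ∈ [1/10,2/5]`, for all
`U ∈ (0,U₀)`, some `κ, c > 0`, eventually along `L = 2(k+1)`, `c κ ≤ E_L(U;κ) − E_L(U;0)`);
`hD` = order-blind depletion of the PENALISED sector blocks `D_{CL}(B_L(κ)) ≤ ε` at every doping of
the window, every `κ ≥ 0`, every `ε > 0`, all `C ≥ C₁(ε)`, eventually in even `L`. Conclusion: the
body of `stub_thermalPenalty` of `Lines/SketchK5.lean`, verbatim, with `U₁ = min (U₀/2) U₂`,
`a = c/2`, `C₀ = C₁(cκ/2)`. Proof: block ground energies are sector energies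
(`CwThesis.stub_blockGroundEnergy`), then `freeEnergy_sub_ge_of_groundEnergy_sub`.
Ruelle (1969) §2.5; Tasaki (2020) §2.2. [folklore] -/
theorem thermalPenalty_of_penaltyResponse_of_depletion :
    (∃ δ ∈ Set.Icc (1 / 10 : ℝ) (2 / 5), ∃ U₀ : ℝ, 0 < U₀ ∧ ∀ U ∈ Set.Ioo (0 : ℝ) U₀,
      ∃ κ : ℝ, 0 < κ ∧ ∃ c : ℝ, 0 < c ∧ ∀ᶠ k : ℕ in Filter.atTop,
        c * κ ≤
          Matrix.minEnergyOn (hubbardTorus 2 (2 * (k + 1)) 1 U +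
              ((κ / ((2 * (k + 1) : ℕ) : ℝ) ^ 4 : ℝ) : ℂ) •
                ((pairField dWaveFormFactor (2 * (k + 1)))ᴴ * pairField dWaveFormFactor (2 * (k + 1))))
            (szSector (2 * ⌊(1 - δ) * ((2 * (k + 1) : ℕ) : ℝ) ^ 2 / 2⌋₊) 0) -
          Matrix.minEnergyOn (hubbardTorus 2 (2 * (k + 1)) 1 U)
            (szSector (2 * ⌊(1 - δ) * ((2 * (k + 1) : ℕ) : ℝ) ^ 2 / 2⌋₊) 0)) →
    (∀ δ ∈ Set.Icc (1 / 10 : ℝ) (2 / 5), ∃ U₂ : ℝ, 0 < U₂ ∧ ∀ U ∈ Set.Ioc (0 : ℝ) U₂,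
      ∀ κ : ℝ, 0 ≤ κ → ∀ ε : ℝ, 0 < ε → ∃ C₁ : ℝ, 0 < C₁ ∧ ∀ C : ℝ, C₁ ≤ C →
        ∃ L₀ : ℕ, ∀ (L : ℕ) [NeZero L], L₀ ≤ L → Even L →
          ((hubbardTorus 2 L 1 U + ((κ / (L : ℝ) ^ 4 : ℝ) : ℂ) •
                ((pairField dWaveFormFactor L)ᴴ * pairField dWaveFormFactor L)).toBlock
              (fun s => (upPart s).card = ⌊(1 - δ) * (L : ℝ) ^ 2 / 2⌋₊ ∧
                (downPart s).card = ⌊(1 - δ) * (L : ℝ) ^ 2 / 2⌋₊)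
              (fun s => (upPart s).card = ⌊(1 - δ) * (L : ℝ) ^ 2 / 2⌋₊ ∧
                (downPart s).card = ⌊(1 - δ) * (L : ℝ) ^ 2 / 2⌋₊)).groundEnergy -
            -(1 / (C * L)) * Real.log (partitionFn (C * L)
                ((hubbardTorus 2 L 1 U + ((κ / (L : ℝ) ^ 4 : ℝ) : ℂ) •
                    ((pairField dWaveFormFactor L)ᴴ * pairField dWaveFormFactor L)).toBlock
                  (fun s => (upPart s).card = ⌊(1 - δ) * (L : ℝ) ^ 2 / 2⌋₊ ∧
                    (downPart s).card = ⌊(1 - δ) * (L : ℝ) ^ 2 / 2⌋₊)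
                  (fun s => (upPart s).card = ⌊(1 - δ) * (L : ℝ) ^ 2 / 2⌋₊ ∧
                    (downPart s).card = ⌊(1 - δ) * (L : ℝ) ^ 2 / 2⌋₊))).re ≤ ε) →
    ∃ U₁ : ℝ, 0 < U₁ ∧ ∃ δ ∈ Set.Icc (1 / 10 : ℝ) (2 / 5), ∀ U ∈ Set.Ioc (0 : ℝ) U₁,
      ∃ κ : ℝ, 0 < κ ∧ ∃ a : ℝ, 0 < a ∧ ∃ C₀ : ℝ, ∀ C : ℝ, C₀ ≤ C →
        ∃ L₀ : ℕ, ∀ (L : ℕ) [NeZero L], L₀ ≤ L → Even L →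
          a * κ ≤
            -(1 / (C * L)) * Real.log (partitionFn (C * L)
                ((hubbardTorus 2 L 1 U + ((κ / (L : ℝ) ^ 4 : ℝ) : ℂ) •
                    ((pairField dWaveFormFactor L)ᴴ * pairField dWaveFormFactor L)).toBlock
                  (fun s => (upPart s).card = ⌊(1 - δ) * (L : ℝ) ^ 2 / 2⌋₊ ∧
                    (downPart s).card = ⌊(1 - δ) * (L : ℝ) ^ 2 / 2⌋₊)
                  (fun s => (upPart s).card = ⌊(1 - δ) * (L : ℝ) ^ 2 / 2⌋₊ ∧
                    (downPart s).card = ⌊(1 - δ) * (L : ℝ) ^ 2 / 2⌋₊))).re -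
            -(1 / (C * L)) * Real.log (partitionFn (C * L)
                ((hubbardTorus 2 L 1 U).toBlock
                  (fun s => (upPart s).card = ⌊(1 - δ) * (L : ℝ) ^ 2 / 2⌋₊ ∧
                    (downPart s).card = ⌊(1 - δ) * (L : ℝ) ^ 2 / 2⌋₊)
                  (fun s => (upPart s).card = ⌊(1 - δ) * (L : ℝ) ^ 2 / 2⌋₊ ∧
                    (downPart s).card = ⌊(1 - δ) * (L : ℝ) ^ 2 / 2⌋₊))).re := by
  intro hP hD
  obtain ⟨δ, hδ, U₀, hU₀, hPU⟩ := hP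
  obtain ⟨U₂, hU₂, hDU⟩ := hD δ hδ
  refine ⟨min (U₀ / 2) U₂, lt_min (half_pos hU₀) hU₂, δ, hδ, fun U hU => ?_⟩
  have hU0 : U ∈ Set.Ioo (0 : ℝ) U₀ :=
    ⟨hU.1, lt_of_le_of_lt (hU.2.trans (min_le_left _ _)) (half_lt_self hU₀)⟩
  have hU2 : U ∈ Set.Ioc (0 : ℝ) U₂ := ⟨hU.1, hU.2.trans (min_le_right _ _)⟩
  obtain ⟨κ, hκ, c, hc, hev⟩ := hPU U hU0
  obtain ⟨k₀, hk₀⟩ := Filter.eventually_atTop.1 hev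
  obtain ⟨C₁, hC₁, hDC⟩ := hDU U hU2 κ hκ.le (c * κ / 2) (by positivity)
  refine ⟨κ, hκ, c / 2, by positivity, C₁, fun C hC => ?_⟩
  obtain ⟨L₁, hL₁⟩ := hDC C hC
  refine ⟨2 * (k₀ + 1) + L₁, fun L _ hL hLeven => ?_⟩
  -- write the even side as `L = 2(k+1)` with `k ≥ k₀`
  obtain ⟨k, rfl⟩ := exists_eq_two_mul_succ hLeven (by omega)
  have hk : k₀ ≤ k := by omega
  have hδ' : (-1 : ℝ) ≤ δ := by linarith [hδ.1]
  have hn : ⌊(1 - δ) * ((2 * (k + 1) : ℕ) : ℝ) ^ 2 / 2⌋₊ ≤ (2 * (k + 1)) ^ 2 :=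
    Summit.HubbardSuperconductivity.NoGo.floor_pairNumber_le δ hδ' (2 * (k + 1))
  -- the `(n,n)` sector is nonempty (`pairSet α α` for an `n`-subset `α` of the `L²` sites)
  haveI : Nonempty {s : Finset (Orb (FermionTorus 2 (2 * (k + 1)))) //
      (upPart s).card = ⌊(1 - δ) * ((2 * (k + 1) : ℕ) : ℝ) ^ 2 / 2⌋₊ ∧
        (downPart s).card = ⌊(1 - δ) * ((2 * (k + 1) : ℕ) : ℝ) ^ 2 / 2⌋₊} := by
    have hcard : Fintype.card (FermionTorus 2 (2 * (k + 1))) = (2 * (k + 1)) ^ 2 :=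
      Summit.HubbardSuperconductivity.NoGo.card_fermionTorus_two _
    obtain ⟨α, -, hα⟩ := Finset.exists_subset_card_eq
      (s := (Finset.univ : Finset (FermionTorus 2 (2 * (k + 1)))))
      (n := ⌊(1 - δ) * ((2 * (k + 1) : ℕ) : ℝ) ^ 2 / 2⌋₊) (by rw [Finset.card_univ, hcard]; exact hn)
    exact ⟨⟨pairSet α α, by rw [upPart_pairSet, hα], by rw [downPart_pairSet, hα]⟩⟩
  have hCpos : 0 < C := lt_of_lt_of_le hC₁ hC
  have hβ : 0 < C * ((2 * (k + 1) : ℕ) : ℝ) := by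
    have : (0 : ℝ) < ((2 * (k + 1) : ℕ) : ℝ) := by positivity
    positivity
  -- the zero-temperature response at this side, in block form
  have hresp := hk₀ k hk
  have hHh : (hubbardTorus 2 (2 * (k + 1)) 1 U).IsHermitian := LiebThm1.hamiltonian_isHermitian _ 1 U
  have hBh : (hubbardTorus 2 (2 * (k + 1)) 1 U + ((κ / ((2 * (k + 1) : ℕ) : ℝ) ^ 4 : ℝ) : ℂ) •
      ((pairField dWaveFormFactor (2 * (k + 1)))ᴴ * pairField dWaveFormFactor (2 * (k + 1)))).IsHermitian := by
    have h2 : ((pairField dWaveFormFactor (2 * (k + 1)))ᴴ *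
        pairField dWaveFormFactor (2 * (k + 1))).IsHermitian :=
      (pairField_conjTranspose_mul_self_posSemidef dWaveFormFactor _).isHermitian
    refine hHh.add ?_
    unfold Matrix.IsHermitian
    rw [conjTranspose_smul, h2.eq, Complex.star_def, Complex.conj_ofReal]
  rw [← Summit.HubbardSuperconductivity.HubbardSuperconductivity.Theorems.CwThesis.stub_blockGroundEnergy
      (2 * (k + 1)) _ hBh hn,
    ← Summit.HubbardSuperconductivity.HubbardSuperconductivity.Theorems.CwThesis.stub_blockGroundEnergy
      (2 * (k + 1)) _ hHh hn] at hresp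
  -- the depletion of the penalised block at this side
  have hdep := hL₁ (2 * (k + 1)) (by omega) hLeven
  have e : c / 2 * κ + c * κ / 2 = c * κ := by ring
  exact freeEnergy_sub_ge_of_groundEnergy_sub (by exact hHh.submatrix _) hβ (by rw [e]; exact hresp) hdep

end Summit.HubbardSuperconductivity.TwTipContinuation.SharpSandwich

end
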